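import Summits.QuantumFields.YangMills.Theorems.AlphaInputsT3ACv3InClassSelXsOfNestedRegular
import Summits.QuantumFields.YangMills.Theorems.AlphaInputsT3ACv3AdaptedSelX
import Summits.QuantumFields.YangMills.Theorems.AlphaInputsT3ACHistories
import HarnessLib

/-!
# `AlphaInputsT3ACv3XsClassSelector` — THE ONE-CURRENCY CLASS `𝒞_Xs(k, h, W)` (`adaptedClassT3Xs`): closedness of its W-independent core AT ADMISSIBLE HISTORIES, the MEASURABLE
# ARGMIN SELECTOR of the Wilson action over `𝒞_Xs ∩ S` for any closed cut `S`, and ★★ `InClassSelT3Xs ⇐ non-emptiness` — cell `ym3-torus`, crux stmt-QuantumFields-19936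
# (`HistoryTailL`, line v5p10), width seat ym-ust-19936-w5 (g4); LEAD ★w1-19936 g3 rows (E1) 09:35Z → (R1) 09:44Z (door of record = Sel∕Xs)

WHY.  The v5p10 stub `stub_laneRecordsV4Chi` is closed, by the door OF RECORD ✓ `historyTailL_of_thm1In8_selXsV4DataRows_allL` (LEAD ruling (R1) 09:44:28Z, after ★w6-19936 g3's
LOCATE ✗ showed the NESTED display `NestedRegularSelT3` unsatisfiable at vortex data), modulo ⟨T8⟩ and the one-currency selection display `PinnedPartsT3ACRecSelXsV4Chi`, whose
per-family clause is `DataRowsT3XsChiSel K Ut := ∃ UkH, InClassSelT3Xs K Ut UkH ∧ ⟨NODE O's data rows for UkH⟩`.  `InClassSelT3Xs` (✓ `…v3RecordSelXsChi` :150) asks for a map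
`UkH k h` PINNED to `Ut` at the trivial history, MEASURABLE, and IN `𝒞_Xs(k, h, W)` at every admissible non-trivial history of level `k ≤ K`.  The tree has the measurable
argmin selector for the COMB-currency class `𝒞_X` (★alpha-2 ✓ `exists_selector_adaptedClassT3X`, core closed by `isClosed_adaptedCoreX` WITHOUT admissibility — comb averages are
continuous everywhere) but NOT for `𝒞_Xs`, whose (67)-conjunct `large67RecSet` reads the SYMMETRIC `(blockAvg ℰp)^j`-average at the recorded plaquettes — continuous only where its
loops are small, i.e. where the recorded plaquettes are READ plaquettes, which is exactly what ADMISSIBILITY of the history gives.  THIS FILE (all def-free):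
* §1 geometry at ADMISSIBLE histories: a recorded plaquette `p ∈ P_j(h)`, `j < k`, lies in `plaqsIn j (Λ_j(h))` (`mem_plaqsIn_lam42_of_mem_hist`, from
  `plaqCover_subset_Lam_of_admissible`), so its four bonds are READ bonds (`plaqBonds_mem_readBondsT3_of_mem_hist`) and its `(ℰp)^j` plaquette variable is continuous on the
  seam-blind small-loop class (`continuousOn_plaqHol_iter_of_mem_hist`);
* §2 topology: ★ `isClosed_localSmallT3X_inter_large67RecSet`, ★ `isClosed_adaptedCoreXs` — the W-independent core `localSmallT3X ∩ (reg68LocalSet ∩ large67RecSet)` is CLOSED at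
  admissible histories (`k ≤ K`); `isClosed_fineRegularOn` — a fine-plaquette `≤`-regularity cut on the regions is closed (tool for print-verbatim re-cuts, LEAD (R2));
* §3 ★★ `exists_selector_adaptedClassT3Xs_inter` — the measurable argmin selector of `wilsonAction4` over `𝒞_Xs(k, h, W) ∩ S` for ANY closed W-independent `S` (closed class,
  top average patched to `1` off the read bonds, the charged window as an OPEN guard of a closed relation — ★alpha-2's pattern), minimisers by compactness;
* §4 ★★ `exists_inClassSelT3Xs_of_nonempty` — for a measurable trivial-history family `Ut` and closed cuts `S k h`: NON-EMPTINESS of `𝒞_Xs(k, h, W) ∩ S k h` at every admissible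
  non-trivial `(k, h, W)`, `k ≤ K` ⟹ `∃ UkH, InClassSelT3Xs F 𝔠 γ hγ hγ1 K Ut UkH ∧` (argmin over the cut class); `…_of_nonempty_univ` the uncut instance.  So the selection row of the
  door of record is a THEOREM modulo the KINEMATIC non-emptiness of `𝒞_Xs` (comb twin ✓ `adaptedClassNonemptyT3X_of_innerLift_of_sizes'` ⇐ (FL)∕M22; one-currency remainder =
  ★w4-19936 g4's located (U2): recording-currency largeness of the abelian profile∕glue).
HONEST FRAMING.  Kinematics ∕ topology ∕ measurable selection only.  The selected configuration is an argmin over `𝒞_Xs` (a class with FREE seams and (68) at half constant), NOT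
claimed to be print's (42)-minimiser, and its interiority is NOT claimed (★alpha-2's bill L2: that identification is part of NODE O's rows 22–23 for this map); non-emptiness is a
HYPOTHESIS here.  Nothing of [Balaban1985UV3]∕[Balaban1985Variational]'s estimates is asserted; the stub 2′χ, the crux `HistoryTailL`, T8 and any gap are NOT claimed; count-neutral
helper (`--supports stmt-QuantumFields-19936`); registry untouched.  YM₃ on the three-torus is rung R3 of the programme, NOT the Clay problem (no bearing on d = 4, infinite volume,
or a mass gap).

References: T. Bałaban, Commun. Math. Phys. 102 (1985) 277–309 [Balaban1985Variational] ((2)–(3) p.278, Thm 1 (8) p.279); Commun. Math. Phys. 102 (1985) 255–275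
[Balaban1985UV3] ((42) p.266, (67)–(68) p.273, p.273 L14); Commun. Math. Phys. 109 (1987) 249–301 [Balaban1987RG1] ((0.4) p.253); C. D. Aliprantis, K. C. Border, Infinite
Dimensional Analysis (2006) Thm 18.19 [AliprantisBorder2006].
-/

set_option autoImplicit false

noncomputable section

namespace Summit.QuantumFields.YangMills.Theorems

open MeasureTheory Set Topology TopologicalSpace
open scoped Matrix Matrix.Norms.L2Operator
open Literature.MathematicalPhysics.QuantumFieldTheory.Balaban1983to89
open Literature.MathematicalPhysics.QuantumFieldTheory.Balaban1983to89.B10 (pFun)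
open Literature.MathematicalPhysics.QuantumFieldTheory.Balaban1983to89.T3ContinuumYM3Torus
open Literature.MathematicalPhysics.QuantumFieldTheory.Balaban1983to89.T3UnitLawDensityEML (ℰp)
open Literature.MathematicalPhysics.QuantumFieldTheory.Balaban1983to89.T3UnitScaleTilt (θBal)
open Literature.MathematicalPhysics.QuantumFieldTheory.Balaban1983to89.ExpMeanLog (deltaSU)
open Literature.MathematicalPhysics.QuantumFieldTheory.Balaban1983to89.B10Eq38TorusDomains (toFine cornerSet plaqsIn mem_plaqsIn_iff)
open Literature.MathematicalPhysics.QuantumFieldTheory.Balaban1983to89.B10Eq42TorusConstraint (bondsIn lam42 lam42_of_lt)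
open Literature.MathematicalPhysics.QuantumFieldTheory.Balaban1985CMP102.Setting
open Summit.QuantumFields.Balaban3D.Carriers
open Summit.QuantumFields.Balaban3D.Proofs.Primitives (AlphaConsts)
open Summit.QuantumFields.BalabanUV.T4Continuum.SubstrateBlockAvgContinuity (smallContinuous_expMeanLogSU)
open Summit.QuantumFields.YangMills.Theorems.BalabanUVNodesN08AlphaGroupTopology
open Summit.QuantumFields.YangMills.Theorems.LocalSmallLoop (continuousOn_plaqHol_iter₂)

section T3

variable {F : T3Family} {𝔠 : AlphaConsts F.L (suGroupModel 2).N} {γ : ℝ} {hγ : 0 < γ} {hγ1 : γ ≤ (min 𝔠.gamma0 1) ^ 2} {K : ℕ}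

/-! ## §1 Geometry at admissible histories: recorded plaquettes are read plaquettes -/

/-- **A RECORDED PLAQUETTE LIES IN `Λ_j(h)`** at an admissible history of level `k ≤ K`: `p ∈ P_j(h)`, `j < k` ⟹ `p ∈ plaqsIn j (lam42 Ω(h) k j)` (its four fine corner
representatives are covered sites, `plaqCover_subset_Lam_of_admissible`). [cite: Balaban1985UV3, p.273 L14] -/
theorem AlphaInputsT3AC.mem_plaqsIn_lam42_of_mem_hist {k : ℕ} (hk : k ≤ K) {h : Hist (F.P K) k}
    (hh : Hist.Admissible 𝔠.lane.carrier.M₁ (rcolOf (T3Scales F γ hγ (hγ1.trans (sq_min_one_le _ 𝔠.gamma0_pos)) K) 𝔠.lane.carrier) k h)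
    (j : Fin k) {p : Plaq (F.P K) j} (hp : p ∈ h j) :
    p ∈ plaqsIn (j : ℕ) (lam42 (Omega 𝔠.lane.carrier.M₁
      (rcolOf (T3Scales F γ hγ (hγ1.trans (sq_min_one_le _ 𝔠.gamma0_pos)) K) 𝔠.lane.carrier) k h) k j) := by
  rw [mem_plaqsIn_iff, lam42_of_lt j.isLt]
  have hjK : (j : ℕ) ≤ (F.P K).m + (F.P K).K := (le_of_lt j.isLt).trans (AlphaInputsT3AC.le_standing_of_le hk)
  exact (cornerSet_subset_plaqCover hjK p).trans (plaqCover_subset_Lam_of_admissible _ _ k h hh j j.isLt p hp)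

/-- The four bonds of a recorded plaquette of an admissible history are READ bonds of its level. [cite: Balaban1985UV3, (67) p.273] -/
theorem AlphaInputsT3AC.plaqBonds_mem_readBondsT3_of_mem_hist {k : ℕ} (hk : k ≤ K) {h : Hist (F.P K) k}
    (hh : Hist.Admissible 𝔠.lane.carrier.M₁ (rcolOf (T3Scales F γ hγ (hγ1.trans (sq_min_one_le _ 𝔠.gamma0_pos)) K) 𝔠.lane.carrier) k h)
    (j : Fin k) {p : Plaq (F.P K) j} (hp : p ∈ h j) :
    (⟨p.src, p.μ⟩ : PBond (F.P K) j) ∈ AlphaInputsT3AC.readBondsT3 F 𝔠 γ hγ hγ1 K k h j ∧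
      (⟨p.src.shift p.μ, p.ν⟩ : PBond (F.P K) j) ∈ AlphaInputsT3AC.readBondsT3 F 𝔠 γ hγ hγ1 K k h j ∧
      (⟨p.src.shift p.ν, p.μ⟩ : PBond (F.P K) j) ∈ AlphaInputsT3AC.readBondsT3 F 𝔠 γ hγ hγ1 K k h j ∧
      (⟨p.src, p.ν⟩ : PBond (F.P K) j) ∈ AlphaInputsT3AC.readBondsT3 F 𝔠 γ hγ hγ1 K k h j :=
  AlphaInputsT3AC.plaqBonds_mem_readBondsT3 (i := j) (s := j) (le_of_lt j.isLt) le_rfl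
    (AlphaInputsT3AC.mem_plaqsIn_lam42_of_mem_hist (hγ1 := hγ1) hk hh j hp)

/-- On the seam-blind small-loop class the plaquette variable of the `j`-fold `ℰp`-average at a RECORDED plaquette of an admissible history is continuous.
[cite: Balaban1987RG1, (0.4) p.253] -/
theorem AlphaInputsT3AC.continuousOn_plaqHol_iter_of_mem_hist {k : ℕ} (hk : k ≤ K) {h : Hist (F.P K) k}
    (hh : Hist.Admissible 𝔠.lane.carrier.M₁ (rcolOf (T3Scales F γ hγ (hγ1.trans (sq_min_one_le _ 𝔠.gamma0_pos)) K) 𝔠.lane.carrier) k h)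
    (j : Fin k) {p : Plaq (F.P K) j} (hp : p ∈ h j) :
    ContinuousOn (fun U : GaugeField (F.P K) 0 (Matrix.specialUnitaryGroup (Fin 2) ℂ) =>
      GaugeField.plaqHol (Averaging.iter (fun l => BlockAveraging.blockAvg (P := F.P K) (j := l) ℰp) j U) p)
      (AlphaInputsT3AC.localSmallT3X F 𝔠 γ hγ hγ1 K k h) := by
  obtain ⟨h₁, h₂, h₃, h₄⟩ := AlphaInputsT3AC.plaqBonds_mem_readBondsT3_of_mem_hist hk hh j hp
  exact continuousOn_plaqHol_iter₂ AlphaInputsT3AC.continuous_dist1_su2 smallContinuous_expMeanLogSU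
    (by show ℰp.δ / 2 < ℰp.δ; linarith [ℰp.δ_pos]) (AlphaInputsT3AC.depClosed₂_readBondsT3 hk h)
    (AlphaInputsT3AC.le_standing_of_le hk) (le_of_lt j.isLt) p h₁ h₂ h₃ h₄

/-! ## §2 Topology: the one-currency core is closed at admissible histories; the fine regularity cut is closed -/

/-- **THE RECORDING-CURRENCY (67) SET IS CLOSED RELATIVE TO THE SEAM-BLIND CLASS** at an admissible history (`k ≤ K`): finitely many conditions `c ≤ dist1 (…)` on maps
continuous there. [cite: Balaban1985UV3, (67) p.273] -/
theorem AlphaInputsT3AC.isClosed_localSmallT3X_inter_large67RecSet {k : ℕ} (hk : k ≤ K) {h : Hist (F.P K) k}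
    (hh : Hist.Admissible 𝔠.lane.carrier.M₁ (rcolOf (T3Scales F γ hγ (hγ1.trans (sq_min_one_le _ 𝔠.gamma0_pos)) K) 𝔠.lane.carrier) k h) :
    IsClosed (AlphaInputsT3AC.localSmallT3X F 𝔠 γ hγ hγ1 K k h ∩ AlphaInputsT3AC.large67RecSet F 𝔠 γ hγ hγ1 K k h) := by
  have hN := AlphaInputsT3AC.isClosed_localSmallT3X (𝔠 := 𝔠) (hγ := hγ) (hγ1 := hγ1) hk h
  have hset : AlphaInputsT3AC.localSmallT3X F 𝔠 γ hγ hγ1 K k h ∩ AlphaInputsT3AC.large67RecSet F 𝔠 γ hγ hγ1 K k h =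
      AlphaInputsT3AC.localSmallT3X F 𝔠 γ hγ hγ1 K k h ∩ ⋂ (j : Fin k), ⋂ (p : Plaq (F.P K) j), ⋂ (_ : p ∈ h j),
        (AlphaInputsT3AC.localSmallT3X F 𝔠 γ hγ hγ1 K k h ∩ {U |
          eps1Of (T3Scales F γ hγ (hγ1.trans (sq_min_one_le _ 𝔠.gamma0_pos)) K) 𝔠.lane.carrier j ≤
            GaugeGroup.dist1 (GaugeField.plaqHol (Averaging.iter (fun l => BlockAveraging.blockAvg (P := F.P K) (j := l) ℰp) j U) p)}) := by
    ext U
    simp only [AlphaInputsT3AC.large67RecSet, mem_inter_iff, mem_setOf_eq, mem_iInter]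
    exact ⟨fun hU => ⟨hU.1, fun j p hp => ⟨hU.1, hU.2 j p hp⟩⟩, fun hU => ⟨hU.1, fun j p hp => (hU.2 j p hp).2⟩⟩
  rw [hset]
  exact hN.inter (isClosed_iInter fun j => isClosed_iInter fun p => isClosed_iInter fun hp =>
    (AlphaInputsT3AC.continuous_dist1_su2.comp_continuousOn
      (AlphaInputsT3AC.continuousOn_plaqHol_iter_of_mem_hist hk hh j hp)).preimage_isClosed_of_isClosed hN isClosed_Ici)

/-- **THE W-INDEPENDENT CORE OF `𝒞_Xs` IS CLOSED AT AN ADMISSIBLE HISTORY** (`k ≤ K`): seam-blind small-loop class ∩ (read-local (68) set ∩ recording-currency (67)-largeness).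
[cite: Balaban1985UV3, (67)–(68) p.273] -/
theorem AlphaInputsT3AC.isClosed_adaptedCoreXs {k : ℕ} (hk : k ≤ K) {h : Hist (F.P K) k}
    (hh : Hist.Admissible 𝔠.lane.carrier.M₁ (rcolOf (T3Scales F γ hγ (hγ1.trans (sq_min_one_le _ 𝔠.gamma0_pos)) K) 𝔠.lane.carrier) k h) :
    IsClosed (AlphaInputsT3AC.localSmallT3X F 𝔠 γ hγ hγ1 K k h ∩
      (AlphaInputsT3AC.reg68LocalSet F 𝔠 γ hγ hγ1 K k h ∩ AlphaInputsT3AC.large67RecSet F 𝔠 γ hγ hγ1 K k h)) := by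
  have hR := AlphaInputsT3AC.isClosed_reg68LocalSet (𝔠 := 𝔠) (hγ := hγ) (hγ1 := hγ1) hk h
  have hL := AlphaInputsT3AC.isClosed_localSmallT3X_inter_large67RecSet (𝔠 := 𝔠) (hγ := hγ) (hγ1 := hγ1) hk hh
  have hset : AlphaInputsT3AC.localSmallT3X F 𝔠 γ hγ hγ1 K k h ∩
      (AlphaInputsT3AC.reg68LocalSet F 𝔠 γ hγ hγ1 K k h ∩ AlphaInputsT3AC.large67RecSet F 𝔠 γ hγ hγ1 K k h) =
      AlphaInputsT3AC.reg68LocalSet F 𝔠 γ hγ hγ1 K k h ∩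
        (AlphaInputsT3AC.localSmallT3X F 𝔠 γ hγ hγ1 K k h ∩ AlphaInputsT3AC.large67RecSet F 𝔠 γ hγ hγ1 K k h) := by
    ext U
    simp only [mem_inter_iff]
    tauto
  rw [hset]
  exact hR.inter hL

/-- The level-0 plaquette variable is continuous on `SU(2)^{bonds}`. [folklore] -/
theorem AlphaInputsT3AC.continuous_dist1_plaqHol_zero (p : Plaq (F.P K) 0) :
    Continuous fun U : GaugeField (F.P K) 0 (Matrix.specialUnitaryGroup (Fin 2) ℂ) => GaugeGroup.dist1 (GaugeField.plaqHol U p) :=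
  AlphaInputsT3AC.continuous_dist1_su2.comp (continuous_plaqHol p)

/-- **THE FINE REGULARITY CUT IS CLOSED**: for any radii `ρ` and any region-indexed finite plaquette sets, `{U | ∀ i ≤ k, ∀ p ∈ plaqsIn 0 (Ω_i(h)), dist1 (U(∂p)) ≤ ρ i·((L^i)⁻¹)²}` is a
closed subset of `SU(2)^{bonds}` (finitely many `≤`-conditions on continuous maps). [cite: Balaban1985UV3, (68) p.273] -/
theorem AlphaInputsT3AC.isClosed_fineRegularOn (ρ : ℕ → ℝ) (k : ℕ) (h : Hist (F.P K) k) :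
    IsClosed {U : GaugeField (F.P K) 0 (Matrix.specialUnitaryGroup (Fin 2) ℂ) | ∀ i, i ≤ k →
      ∀ p ∈ plaqsIn 0 (Omega 𝔠.lane.carrier.M₁ (rcolOf (T3Scales F γ hγ (hγ1.trans (sq_min_one_le _ 𝔠.gamma0_pos)) K) 𝔠.lane.carrier) k h i),
        GaugeGroup.dist1 (GaugeField.plaqHol U p) ≤ ρ i * (((F.L : ℝ) ^ i)⁻¹) ^ 2} := by
  simp only [Set.setOf_forall]
  exact isClosed_iInter fun i => isClosed_iInter fun _ => isClosed_iInter fun p => isClosed_iInter fun _ =>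
    isClosed_le (AlphaInputsT3AC.continuous_dist1_plaqHol_zero p) continuous_const

/-! ## §3 The measurable argmin selector over `𝒞_Xs(k, h, W)` cut by a closed W-independent constraint -/

open Classical in
/-- **★ MINIMISERS AND A MEASURABLE ARGMIN SELECTOR FOR THE ONE-CURRENCY CLASS CUT BY A CLOSED CONSTRAINT** (`k ≤ K`, ADMISSIBLE history `h`, any closed
`S ⊆ SU(2)^{bonds}`): (i) a measurable `f : SU(2)^{bonds_k} → SU(2)^{bonds_0}` with `f W ∈ argmin_{𝒞_Xs(k,h,W) ∩ S} A` (Wilson action) wherever a minimiser exists and `f W = 1`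
elsewhere; (ii) a minimiser EXISTS as soon as `𝒞_Xs(k, h, W) ∩ S ≠ ∅`.  ★alpha-2's closed-class selection with `C` = the one-currency core `∩ S`,
`g Ũ = ((blockAvg ℰp)^k Ũ patched to 1 off the read bonds, Ũ)`, `π W = (W, 1)` and the closed relation «`W` charged ⇒ top constraint on the bonds of `Ω_k(h)` ∧ r3».
[cite: Balaban1985Variational, Thm 1 (8) p.279 (existence half by compactness; measurable-selection reading); AliprantisBorder2006, Thm 18.19 p.605] -/
theorem AlphaInputsT3AC.exists_selector_adaptedClassT3Xs_inter {k : ℕ} (hk : k ≤ K) {h : Hist (F.P K) k}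
    (hh : Hist.Admissible 𝔠.lane.carrier.M₁ (rcolOf (T3Scales F γ hγ (hγ1.trans (sq_min_one_le _ 𝔠.gamma0_pos)) K) 𝔠.lane.carrier) k h)
    {S : Set (GaugeField (F.P K) 0 (Matrix.specialUnitaryGroup (Fin 2) ℂ))} (hS : IsClosed S) :
    (∃ f : GaugeField (F.P K) k (Matrix.specialUnitaryGroup (Fin 2) ℂ) → GaugeField (F.P K) 0 (Matrix.specialUnitaryGroup (Fin 2) ℂ),
      Measurable f ∧
      (∀ W, (∃ U ∈ AlphaInputsT3AC.adaptedClassT3Xs F 𝔠 γ hγ hγ1 K k h W ∩ S,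
          IsMinOn (fun U : GaugeField (F.P K) 0 (Matrix.specialUnitaryGroup (Fin 2) ℂ) => wilsonAction4 U)
            (AlphaInputsT3AC.adaptedClassT3Xs F 𝔠 γ hγ hγ1 K k h W ∩ S) U) →
        f W ∈ AlphaInputsT3AC.adaptedClassT3Xs F 𝔠 γ hγ hγ1 K k h W ∩ S ∧
          IsMinOn (fun U : GaugeField (F.P K) 0 (Matrix.specialUnitaryGroup (Fin 2) ℂ) => wilsonAction4 U)
            (AlphaInputsT3AC.adaptedClassT3Xs F 𝔠 γ hγ hγ1 K k h W ∩ S) (f W)) ∧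
      (∀ W, ¬ (∃ U ∈ AlphaInputsT3AC.adaptedClassT3Xs F 𝔠 γ hγ hγ1 K k h W ∩ S,
          IsMinOn (fun U : GaugeField (F.P K) 0 (Matrix.specialUnitaryGroup (Fin 2) ℂ) => wilsonAction4 U)
            (AlphaInputsT3AC.adaptedClassT3Xs F 𝔠 γ hγ hγ1 K k h W ∩ S) U) → f W = 1)) ∧
    (∀ W, (AlphaInputsT3AC.adaptedClassT3Xs F 𝔠 γ hγ hγ1 K k h W ∩ S).Nonempty →
      ∃ U ∈ AlphaInputsT3AC.adaptedClassT3Xs F 𝔠 γ hγ hγ1 K k h W ∩ S,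
        IsMinOn (fun U : GaugeField (F.P K) 0 (Matrix.specialUnitaryGroup (Fin 2) ℂ) => wilsonAction4 U)
          (AlphaInputsT3AC.adaptedClassT3Xs F 𝔠 γ hγ hγ1 K k h W ∩ S) U) := by
  haveI : CompactSpace (GaugeField (F.P K) 0 (Matrix.specialUnitaryGroup (Fin 2) ℂ)) :=
    inferInstanceAs (CompactSpace (PBond (F.P K) 0 → Matrix.specialUnitaryGroup (Fin 2) ℂ))
  haveI : PolishSpace (Matrix.specialUnitaryGroup (Fin 2) ℂ) := polishSpace_rho (suGroupModel 2)
  haveI : PolishSpace (GaugeField (F.P K) 0 (Matrix.specialUnitaryGroup (Fin 2) ℂ)) :=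
    inferInstanceAs (PolishSpace (PBond (F.P K) 0 → Matrix.specialUnitaryGroup (Fin 2) ℂ))
  haveI : SecondCountableTopology (GaugeField (F.P K) 0 (Matrix.specialUnitaryGroup (Fin 2) ℂ)) :=
    inferInstanceAs (SecondCountableTopology (PBond (F.P K) 0 → Matrix.specialUnitaryGroup (Fin 2) ℂ))
  haveI : BorelSpace (GaugeField (F.P K) 0 (Matrix.specialUnitaryGroup (Fin 2) ℂ)) :=
    inferInstanceAs (BorelSpace (PBond (F.P K) 0 → Matrix.specialUnitaryGroup (Fin 2) ℂ))
  haveI : SecondCountableTopology (GaugeField (F.P K) k (Matrix.specialUnitaryGroup (Fin 2) ℂ)) :=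
    inferInstanceAs (SecondCountableTopology (PBond (F.P K) k → Matrix.specialUnitaryGroup (Fin 2) ℂ))
  haveI : BorelSpace (GaugeField (F.P K) k (Matrix.specialUnitaryGroup (Fin 2) ℂ)) :=
    inferInstanceAs (BorelSpace (PBond (F.P K) k → Matrix.specialUnitaryGroup (Fin 2) ℂ))
  -- the data of the closed-class selection: the one-currency core cut by `S`
  let C : Set (GaugeField (F.P K) 0 (Matrix.specialUnitaryGroup (Fin 2) ℂ)) :=
    (AlphaInputsT3AC.localSmallT3X F 𝔠 γ hγ hγ1 K k h ∩
      (AlphaInputsT3AC.reg68LocalSet F 𝔠 γ hγ hγ1 K k h ∩ AlphaInputsT3AC.large67RecSet F 𝔠 γ hγ hγ1 K k h)) ∩ S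
  have hC : IsClosed C := (AlphaInputsT3AC.isClosed_adaptedCoreXs (𝔠 := 𝔠) (hγ := hγ) (hγ1 := hγ1) hk hh).inter hS
  -- the level-`k` average of record PATCHED to `1` off the read bonds (continuous on the core)
  let patch : GaugeField (F.P K) 0 (Matrix.specialUnitaryGroup (Fin 2) ℂ) → GaugeField (F.P K) k (Matrix.specialUnitaryGroup (Fin 2) ℂ) :=
    fun U b => if b ∈ AlphaInputsT3AC.readBondsT3 F 𝔠 γ hγ hγ1 K k h k then
      Averaging.iter (fun i => BlockAveraging.blockAvg (P := F.P K) (j := i) ℰp) k U b else 1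
  have hpatch : ContinuousOn patch C := by
    refine continuousOn_pi.2 fun b => ?_
    by_cases hb : b ∈ AlphaInputsT3AC.readBondsT3 F 𝔠 γ hγ hγ1 K k h k
    · simp only [patch, if_pos hb]
      exact (AlphaInputsT3AC.continuousOn_iter_readBondX (𝔠 := 𝔠) (hγ1 := hγ1) hk h le_rfl hb).mono fun U hU => hU.1.1
    · simp only [patch, if_neg hb]
      exact continuousOn_const
  let g : GaugeField (F.P K) 0 (Matrix.specialUnitaryGroup (Fin 2) ℂ) →
      GaugeField (F.P K) k (Matrix.specialUnitaryGroup (Fin 2) ℂ) × GaugeField (F.P K) 0 (Matrix.specialUnitaryGroup (Fin 2) ℂ) :=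
    fun U => (patch U, U)
  have hg : ContinuousOn g C := hpatch.prodMk continuousOn_id
  let π : GaugeField (F.P K) k (Matrix.specialUnitaryGroup (Fin 2) ℂ) →
      GaugeField (F.P K) k (Matrix.specialUnitaryGroup (Fin 2) ℂ) × GaugeField (F.P K) 0 (Matrix.specialUnitaryGroup (Fin 2) ℂ) :=
    fun W => (W, 1)
  have hπ : Measurable π := measurable_id.prodMk measurable_const
  let Sm : Set (GaugeField (F.P K) k (Matrix.specialUnitaryGroup (Fin 2) ℂ)) :=
    {W | ChargedT3 F γ 𝔠.b₀ 𝔠.p₀ (avgWindowFactor F.L) K 𝔠.lane.carrier.M₁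
      (rcolOf (T3Scales F γ hγ (hγ1.trans (sq_min_one_le _ 𝔠.gamma0_pos)) K) 𝔠.lane.carrier) k h W}
  let Bk : Set (PBond (F.P K) k) := bondsIn k (Omega 𝔠.lane.carrier.M₁
      (rcolOf (T3Scales F γ hγ (hγ1.trans (sq_min_one_le _ 𝔠.gamma0_pos)) K) 𝔠.lane.carrier) k h k)
  let D : Set (GaugeField (F.P K) 0 (Matrix.specialUnitaryGroup (Fin 2) ℂ)) :=
    AlphaInputsT3AC.localSmallT3X F 𝔠 γ hγ hγ1 K k h ∩ AlphaInputsT3AC.reg68LevelsSet F 𝔠 γ hγ hγ1 K k h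
  let R : Set ((GaugeField (F.P K) k (Matrix.specialUnitaryGroup (Fin 2) ℂ) × GaugeField (F.P K) 0 (Matrix.specialUnitaryGroup (Fin 2) ℂ)) ×
      (GaugeField (F.P K) k (Matrix.specialUnitaryGroup (Fin 2) ℂ) × GaugeField (F.P K) 0 (Matrix.specialUnitaryGroup (Fin 2) ℂ))) :=
    {p | p.2.1 ∈ Sm → (∀ b ∈ Bk, p.1.1 b = p.2.1 b) ∧ p.1.2 ∈ D}
  have hcoordk : ∀ b : PBond (F.P K) k, Continuous fun V : GaugeField (F.P K) k (Matrix.specialUnitaryGroup (Fin 2) ℂ) => V b :=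
    fun b => continuous_apply b
  have hR : IsClosed R := by
    have hset : R = {p | p.2.1 ∈ Sm}ᶜ ∪ ((⋂ b ∈ Bk, {p | p.1.1 b = p.2.1 b}) ∩ {p | p.1.2 ∈ D}) := by
      ext p
      simp only [R, mem_setOf_eq, mem_union, mem_compl_iff, mem_inter_iff, mem_iInter]
      by_cases hp : p.2.1 ∈ Sm
      · simp only [hp, forall_true_left, not_true_eq_false, false_or]
      · simp only [hp, IsEmpty.forall_iff, not_false_eq_true, true_or]
    rw [hset]
    refine IsClosed.union ?_ (IsClosed.inter (isClosed_biInter fun b _ => ?_) ?_)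
    · exact ((AlphaInputsT3AC.isOpen_chargedT3 (𝔠 := 𝔠) (hγ1 := hγ1) k h).preimage (continuous_fst.comp continuous_snd)).isClosed_compl
    · exact isClosed_eq ((hcoordk b).comp (continuous_fst.comp continuous_fst)) ((hcoordk b).comp (continuous_fst.comp continuous_snd))
    · exact (AlphaInputsT3AC.isClosed_localSmallT3X_inter_reg68LevelsSet (𝔠 := 𝔠) (hγ1 := hγ1) hk h).preimage (continuous_snd.comp continuous_fst)
  -- the bonds of `Ω_k(h)` are read bonds, so the patch does not touch them
  have hBk : ∀ b ∈ Bk, ∀ U, patch U b = Averaging.iter (fun i => BlockAveraging.blockAvg (P := F.P K) (j := i) ℰp) k U b :=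
    fun b hb U => if_pos (AlphaInputsT3AC.mem_readBondsT3_top (𝔠 := 𝔠) (hγ1 := hγ1) hb)
  -- the admissible sets of the selection ARE the cut one-currency classes
  have hadm : ∀ W, {U | U ∈ C ∧ (g U, π W) ∈ R} = AlphaInputsT3AC.adaptedClassT3Xs F 𝔠 γ hγ hγ1 K k h W ∩ S := by
    intro W
    ext U
    simp only [C, g, π, R, Sm, Bk, D, AlphaInputsT3AC.adaptedClassT3Xs, AlphaInputsT3AC.top42Set, mem_setOf_eq, mem_inter_iff]
    constructor
    · rintro ⟨⟨⟨hN, hReg, hL⟩, hS'⟩, hrel⟩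
      refine ⟨⟨hN, hReg, hL, fun hc => ⟨fun b hb => ?_, (hrel hc).2.2⟩⟩, hS'⟩
      rw [← hBk b hb U]; exact (hrel hc).1 b hb
    · rintro ⟨⟨hN, hReg, hL, hrel⟩, hS'⟩
      refine ⟨⟨⟨hN, hReg, hL⟩, hS'⟩, fun hc => ⟨fun b hb => ?_, hN, (hrel hc).2⟩⟩
      rw [hBk b hb U]; exact (hrel hc).1 b hb
  obtain ⟨⟨f, hfm, hfin, hfout⟩, hex⟩ := exists_measurable_argmin_closedClass hπ hC hg hR AlphaInputsT3AC.continuous_wilsonAction4_su2 1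
  simp only [hadm] at hfin hfout hex
  exact ⟨⟨f, hfm, hfin, hfout⟩, hex⟩

/-! ## §4 `InClassSelT3Xs` from NON-EMPTINESS of the (cut) one-currency class -/

open Classical in
/-- ★★ **THE ONE-CURRENCY IN-CLASS SELECTION FROM NON-EMPTINESS.**  Let `Ut` be a MEASURABLE trivial-history family and `S k h` CLOSED W-independent cuts.  If at every admissible
NON-trivial history `h` of level `k ≤ K` and every datum `W` the cut class `𝒞_Xs(k, h, W) ∩ S k h` is NON-EMPTY, then there is a map `UkH` — `Ut` at the trivial histories, the
measurable argmin of §3 elsewhere — with `InClassSelT3Xs F 𝔠 γ hγ hγ1 K Ut UkH` (pin by definition, measurability by the selection theorem, membership by the argmin) AND the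
argmin property over the cut class.  HONEST: an existence∕selection statement; the argmin is NOT claimed to be print's (42)-minimiser.
[cite: Balaban1985Variational, Thm 1 (8) p.279 (existence half by compactness; measurable-selection reading); Balaban1985UV3, (42) p.266 + (67)–(68) p.273; AliprantisBorder2006, Thm 18.19 p.605] -/
theorem AlphaInputsT3AC.exists_inClassSelT3Xs_of_nonempty
    (Ut : (k : ℕ) → GaugeField (F.P K) k (Matrix.specialUnitaryGroup (Fin 2) ℂ) → GaugeField (F.P K) 0 (Matrix.specialUnitaryGroup (Fin 2) ℂ))
    (hUt : ∀ k, Measurable (Ut k))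
    (S : (k : ℕ) → Hist (F.P K) k → Set (GaugeField (F.P K) 0 (Matrix.specialUnitaryGroup (Fin 2) ℂ))) (hS : ∀ k h, IsClosed (S k h))
    (hne : ∀ (k : ℕ), k ≤ K → ∀ (h : Hist (F.P K) k),
      Hist.Admissible 𝔠.lane.carrier.M₁ (rcolOf (T3Scales F γ hγ (hγ1.trans (sq_min_one_le _ 𝔠.gamma0_pos)) K) 𝔠.lane.carrier) k h →
      h ≠ Hist.triv (F.P K) k → ∀ (W : GaugeField (F.P K) k (Matrix.specialUnitaryGroup (Fin 2) ℂ)),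
        (AlphaInputsT3AC.adaptedClassT3Xs F 𝔠 γ hγ hγ1 K k h W ∩ S k h).Nonempty) :
    ∃ UkH : (k : ℕ) → Hist (F.P K) k → GaugeField (F.P K) k (Matrix.specialUnitaryGroup (Fin 2) ℂ) →
        GaugeField (F.P K) 0 (Matrix.specialUnitaryGroup (Fin 2) ℂ),
      AlphaInputsT3AC.InClassSelT3Xs F 𝔠 γ hγ hγ1 K Ut UkH ∧
      ∀ (k : ℕ), k ≤ K → ∀ (h : Hist (F.P K) k),
        Hist.Admissible 𝔠.lane.carrier.M₁ (rcolOf (T3Scales F γ hγ (hγ1.trans (sq_min_one_le _ 𝔠.gamma0_pos)) K) 𝔠.lane.carrier) k h →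
        h ≠ Hist.triv (F.P K) k → ∀ (W : GaugeField (F.P K) k (Matrix.specialUnitaryGroup (Fin 2) ℂ)),
          UkH k h W ∈ AlphaInputsT3AC.adaptedClassT3Xs F 𝔠 γ hγ hγ1 K k h W ∩ S k h ∧
          IsMinOn (fun U : GaugeField (F.P K) 0 (Matrix.specialUnitaryGroup (Fin 2) ℂ) => wilsonAction4 U)
            (AlphaInputsT3AC.adaptedClassT3Xs F 𝔠 γ hγ hγ1 K k h W ∩ S k h) (UkH k h W) := by
  -- per `(k, h)`: §3's selector over the cut class at admissible non-trivial histories of the run, `Ut k` elsewhere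
  have hsel : ∀ (k : ℕ) (h : Hist (F.P K) k),
      ∃ f : GaugeField (F.P K) k (Matrix.specialUnitaryGroup (Fin 2) ℂ) → GaugeField (F.P K) 0 (Matrix.specialUnitaryGroup (Fin 2) ℂ),
        Measurable f ∧ (k ≤ K →
          Hist.Admissible 𝔠.lane.carrier.M₁ (rcolOf (T3Scales F γ hγ (hγ1.trans (sq_min_one_le _ 𝔠.gamma0_pos)) K) 𝔠.lane.carrier) k h →
          h ≠ Hist.triv (F.P K) k → ∀ (W : GaugeField (F.P K) k (Matrix.specialUnitaryGroup (Fin 2) ℂ)),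
            f W ∈ AlphaInputsT3AC.adaptedClassT3Xs F 𝔠 γ hγ hγ1 K k h W ∩ S k h ∧
            IsMinOn (fun U : GaugeField (F.P K) 0 (Matrix.specialUnitaryGroup (Fin 2) ℂ) => wilsonAction4 U)
              (AlphaInputsT3AC.adaptedClassT3Xs F 𝔠 γ hγ hγ1 K k h W ∩ S k h) (f W)) := by
    intro k h
    by_cases hk : k ≤ K
    · by_cases hh : Hist.Admissible 𝔠.lane.carrier.M₁ (rcolOf (T3Scales F γ hγ (hγ1.trans (sq_min_one_le _ 𝔠.gamma0_pos)) K) 𝔠.lane.carrier) k h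
      · by_cases ht : h = Hist.triv (F.P K) k
        · exact ⟨Ut k, hUt k, fun _ _ ht' => absurd ht ht'⟩
        · obtain ⟨⟨f, hfm, hfin, -⟩, hex⟩ :=
            AlphaInputsT3AC.exists_selector_adaptedClassT3Xs_inter (𝔠 := 𝔠) (hγ := hγ) (hγ1 := hγ1) hk hh (hS k h)
          exact ⟨f, hfm, fun _ _ _ W => hfin W (hex W (hne k hk h hh ht W))⟩
      · exact ⟨Ut k, hUt k, fun _ hh' => absurd hh' hh⟩
    · exact ⟨Ut k, hUt k, fun hk' => absurd hk' hk⟩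
  choose f hfm hf using hsel
  -- the map: `Ut` at the trivial histories, the selector elsewhere
  refine ⟨fun k h => if h = Hist.triv (F.P K) k then Ut k else f k h, ⟨fun k => if_pos rfl, fun k h => ?_, fun k hk h hh ht W => ?_⟩,
    fun k hk h hh ht W => ?_⟩
  · -- measurability, branch by branch
    dsimp only
    by_cases ht : h = Hist.triv (F.P K) k
    · rw [if_pos ht]; exact hUt k
    · rw [if_neg ht]; exact hfm k h
  · -- membership in `𝒞_Xs` at an admissible non-trivial history
    dsimp only
    rw [if_neg ht]
    exact (hf k h hk hh ht W).1.1
  · -- the argmin property over the cut class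
    dsimp only
    rw [if_neg ht]
    exact hf k h hk hh ht W

/-- ★★ **THE UNCUT INSTANCE**: non-emptiness of `𝒞_Xs(k, h, W)` itself at every admissible non-trivial `(k, h, W)`, `k ≤ K` ⟹ `∃ UkH, InClassSelT3Xs F 𝔠 γ hγ hγ1 K Ut UkH` with
`UkH k h W` an argmin of the Wilson action over `𝒞_Xs(k, h, W)` — the selection row of the Sel∕Xs display modulo the KINEMATIC non-emptiness row.
[cite: Balaban1985Variational, Thm 1 (8) p.279; Balaban1985UV3, (42) p.266 + (67)–(68) p.273; AliprantisBorder2006, Thm 18.19 p.605] -/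
theorem AlphaInputsT3AC.exists_inClassSelT3Xs_of_nonempty_univ
    (Ut : (k : ℕ) → GaugeField (F.P K) k (Matrix.specialUnitaryGroup (Fin 2) ℂ) → GaugeField (F.P K) 0 (Matrix.specialUnitaryGroup (Fin 2) ℂ))
    (hUt : ∀ k, Measurable (Ut k))
    (hne : ∀ (k : ℕ), k ≤ K → ∀ (h : Hist (F.P K) k),
      Hist.Admissible 𝔠.lane.carrier.M₁ (rcolOf (T3Scales F γ hγ (hγ1.trans (sq_min_one_le _ 𝔠.gamma0_pos)) K) 𝔠.lane.carrier) k h →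
      h ≠ Hist.triv (F.P K) k → ∀ (W : GaugeField (F.P K) k (Matrix.specialUnitaryGroup (Fin 2) ℂ)),
        (AlphaInputsT3AC.adaptedClassT3Xs F 𝔠 γ hγ hγ1 K k h W).Nonempty) :
    ∃ UkH : (k : ℕ) → Hist (F.P K) k → GaugeField (F.P K) k (Matrix.specialUnitaryGroup (Fin 2) ℂ) →
        GaugeField (F.P K) 0 (Matrix.specialUnitaryGroup (Fin 2) ℂ),
      AlphaInputsT3AC.InClassSelT3Xs F 𝔠 γ hγ hγ1 K Ut UkH ∧
      ∀ (k : ℕ), k ≤ K → ∀ (h : Hist (F.P K) k),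
        Hist.Admissible 𝔠.lane.carrier.M₁ (rcolOf (T3Scales F γ hγ (hγ1.trans (sq_min_one_le _ 𝔠.gamma0_pos)) K) 𝔠.lane.carrier) k h →
        h ≠ Hist.triv (F.P K) k → ∀ (W : GaugeField (F.P K) k (Matrix.specialUnitaryGroup (Fin 2) ℂ)),
          UkH k h W ∈ AlphaInputsT3AC.adaptedClassT3Xs F 𝔠 γ hγ hγ1 K k h W ∧
          IsMinOn (fun U : GaugeField (F.P K) 0 (Matrix.specialUnitaryGroup (Fin 2) ℂ) => wilsonAction4 U)
            (AlphaInputsT3AC.adaptedClassT3Xs F 𝔠 γ hγ hγ1 K k h W) (UkH k h W) := by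
  obtain ⟨UkH, hsel, harg⟩ := AlphaInputsT3AC.exists_inClassSelT3Xs_of_nonempty (𝔠 := 𝔠) (hγ := hγ) (hγ1 := hγ1) Ut hUt
    (fun _ _ => Set.univ) (fun _ _ => isClosed_univ) (fun k hk h hh ht W => by rw [Set.inter_univ]; exact hne k hk h hh ht W)
  refine ⟨UkH, hsel, fun k hk h hh ht W => ?_⟩
  have h1 := harg k hk h hh ht W
  rw [Set.inter_univ] at h1
  exact h1

end T3

end Summit.QuantumFields.YangMills.Theorems

end
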